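import Literature.Barriers.CriticalPhenomena.LaceExpansionXSpaceTwoLongLinesLeaves
import HarnessLib

/-!
# Hara's two-long-lines estimate (§3.5) on the Hara–Slade diagrams at `p_c`, assembled: the
# diagram of `Π^{(N)}` is at most `22(2N-1)² (2d·b)² 𝕂¹⁸ κ^{N-5}` — PROVED (in `[0, ∞]`, for every
# `d ≥ 1` with `κ = 2Δ̃_{p_c}Δ_{p_c} ≤ 1`)

Barrier catalogue `Literature/Barriers/CriticalPhenomena/` (D-0021): the last infrastructure layer of
the conditional reduction of `Hara2008_twoLongLinesDiagramBoundPc` (`LaceExpansionXSpaceLemma15Diagrams.lean`,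
Hara 2008, §3.5), continuing `LaceExpansionXSpaceTwoLongLinesLeaves.lean`.

The two-strand insertion (`LaceExpansionXSpaceLongLineInsertion.tsum_M0_mul_le`) run on the stages
of `LaceExpansionXSpaceTwoLongLinesStages.lean` dominates the diagram `Ψ^{(0)} B₁B₂⋯B₁ A₃(·,x)` of
`Π^{(n+1)}_{p_c}` (Heydenreich–van der Hofstad (7.4.10)) by the sum of all its doubly marked
variants; every variant is identified with a leaf of `LaceExpansionXSpaceTwoLongLinesLeaves.lean`
(`pair_le`, `V_pair_le`, `pair_E_le`, `V_E_le`, `same_le`, `V12_le`, `E12_le`), each at most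
`β² 𝕂¹⁸ κ^{n-4}` with `β = 2d·b⁺` the weight of the two erased lines; the number of variants is at
most `22(2n+1)²` ("the total number of choices are bounded by `(2N+1)²`"). PROVED:

* `piNDiagramPc_succ_le_sum`:
  `piNDiagramPc d (n+1) x ≤ 22 (2n+1)² · (2d·b)² · 𝕂¹⁸ · κ^{n-4}` for `d ≥ 1`, `κ ≤ 1`, `x ≠ 0`
  and every `b` dominating `G` on `|y| ≥ |x|/(2n+3) - 1` — Hara's §3.5 with explicit constants, in
  `[0, ∞]` (meaningful when `S̄ < ∞` and `κ < 1`).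

The passage to real constants `C, q` and the conditional reduction of the named fact are in
`LaceExpansionXSpaceTwoLongLinesReduction.lean`.

## References

* T. Hara, Ann. Probab. 36 (2008) 530–593 (arXiv:math-ph/0504021): §3.5 (proof of Lemma 1.5 for
  percolation, "(2N+1)² choices", "at least (N-3) factors of cλ"), §3.4.
* M. Heydenreich, R. van der Hofstad, *Progress in High-Dimensional Percolation and Random
  Graphs*, Springer 2017: (7.4.10), §7.5.2.
-/

noncomputable section

open scoped ENNReal

namespace Literature.Barriers.CriticalPhenomena

open _root_.MeasureTheory Literature.Probability.LatticeModels Literature.Probability.Percolation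

variable {d : ℕ}

/-! ### Coordinate relations between the two marks, in index form -/

/-- Between `B₁(2i)` and `B₁(2i+2k+2)` the strands interchange `k+1` times. [folklore] -/
theorem rel_ee (i k : ℕ) : xor (cAt (2 * i)) (cAt (2 * i + 2 * k + 2)) = Nat.bodd (k + 1) := by
  rw [show 2 * i + 2 * k + 2 = 2 * (i + (k + 1)) by ring, xor_cAt_two_mul]

/-- Between `B₁(2i)` and `B₂(2i+2k+1)`: `k` interchanges. [folklore] -/
theorem rel_eo (i k : ℕ) : xor (cAt (2 * i)) (cAt (2 * i + 2 * k + 1)) = Nat.bodd k := by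
  rw [show 2 * i + 2 * k + 1 = 2 * (i + k) + 1 by ring, cAt_succ_two_mul, xor_cAt_two_mul]

/-- Between `B₂(2i+1)` and `B₁(2i+2k+2)`: `k+1` interchanges. [folklore] -/
theorem rel_oe (i k : ℕ) : xor (cAt (2 * i + 1)) (cAt (2 * i + 2 * k + 2)) = Nat.bodd (k + 1) := by
  rw [cAt_succ_two_mul, show 2 * i + 2 * k + 2 = 2 * (i + (k + 1)) by ring, xor_cAt_two_mul]

/-- Between `B₂(2i+1)` and `B₂(2i+2k+3)`: `k+1` interchanges. [folklore] -/
theorem rel_oo (i k : ℕ) : xor (cAt (2 * i + 1)) (cAt (2 * i + 2 * k + 3)) = Nat.bodd (k + 1) := by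
  rw [cAt_succ_two_mul, show 2 * i + 2 * k + 3 = 2 * (i + (k + 1)) + 1 by ring, cAt_succ_two_mul, xor_cAt_two_mul]

/-- Between `B₁(2i)` and the end (`n = i + t`): `t` interchanges. [folklore] -/
theorem rel_eE (i t : ℕ) : xor (cAt (2 * i)) (cAt (2 * (i + t) + 1)) = Nat.bodd t := by
  rw [cAt_succ_two_mul, xor_cAt_two_mul]

/-- Between `B₂(2i+1)` and the end (`n = i + t + 1`): `t+1` interchanges. [folklore] -/
theorem rel_oE (i t : ℕ) : xor (cAt (2 * i + 1)) (cAt (2 * (i + t + 1) + 1)) = Nat.bodd (t + 1) := by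
  rw [cAt_succ_two_mul, cAt_succ_two_mul, show i + t + 1 = i + (t + 1) by ring, xor_cAt_two_mul]

/-! ### Currency -/

/-- Two weights and a leaf. [folklore] -/
theorem scal2_le {s₁ s₂ T B W : ℝ≥0∞} (h₁ : s₁ ≤ W) (h₂ : s₂ ≤ W) (hT : T ≤ B) : s₁ * (s₂ * T) ≤ W ^ 2 * B := by
  calc s₁ * (s₂ * T) ≤ W * (W * B) := mul_le_mul' h₁ (mul_le_mul' h₂ hT)
    _ = W ^ 2 * B := by ring

/-- Fewer free units only help (`κ ≤ 1`). [folklore] -/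
theorem kpow_mono (hκ : kap d ≤ 1) {a e : ℕ} (h : a ≤ e) : bigK d ^ 18 * kap d ^ e ≤ bigK d ^ 18 * kap d ^ a :=
  mul_le_mul' le_rfl (pow_le_pow_of_le_one zero_le hκ h)

/-- Unfolding of the weighted variants (unapplied). [folklore] -/
theorem b1Var_eq (b : ℝ) (c : Bool) : b1Var d b c = fun p q => wβc d b c * b1Er d c p q := rfl

/-- Unfolding of `b2Var`. [folklore] -/
theorem b2Var_eq (b : ℝ) (c : Bool) : b2Var d b c = fun p q => wβ₁ b * kRungL (kRungR (b2oneCore d c)) p q := rfl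

/-- Unfolding of `stVar`. [folklore] -/
theorem stVar_eq (b : ℝ) : stVar d b = fun p q => wβ₁ b * kB2twoEr d p q := rfl

/-- Unfolding of `b1Both`. [folklore] -/
theorem b1Both_eq (b : ℝ) : b1Both d b = fun p q => wβ₁ b * wβ₂ d b * kProp (oneF d) (oneF d) p q := rfl

/-- Unfolding of `b2Both`. [folklore] -/
theorem b2Both_eq (b : ℝ) : b2Both d b = fun p q => wβ₁ b ^ 2 * kRungL (kRungR (kPropX (oneF d) (oneF d))) p q := rfl

/-- A constant on the closing vector comes out. [folklore] -/
theorem tsum_mul_const_mul {α : Type*} (f g : α → ℝ≥0∞) (c : ℝ≥0∞) : ∑' q, f q * (c * g q) = c * ∑' q, f q * g q := by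
  rw [← ENNReal.tsum_mul_left]
  exact tsum_congr fun q => by ring

/-! ### Dispatch: every doubly marked chain is a leaf -/

section Dispatch

variable (hd : 1 ≤ d) (hκ : kap d ≤ 1) (x : Site d) {b : ℝ} {n : ℕ}
include hd hκ

/-- **Both marks inside the fine stages**, at positions `j < l`, for the strand on coordinate `c` at
`j` and the other strand (coordinate `c'` at `l`): `≤ β² 𝕂¹⁸ κ^{n-4}`. [cite: Hara2008, §3.5] -/
theorem pair_le (j l : ℕ) (hjl : j < l) (hl : l < 2 * n + 1) (c c' : Bool)
    (hcc : c' = (!xor c (xor (cAt j) (cAt l))))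
    {M M' : Site d × Site d → Site d × Site d → ℝ≥0∞} (hM : M ∈ varsAt d b j c) (hM' : M' ∈ varsAt d b l c') :
    ∑' s, pkChainL (kPsiZero d) (((altL d true (2 * n + 1)).set j M).set l M') s * kA3end d s x ≤
      wβ d b ^ 2 * (bigK d ^ 18 * kap d ^ (n - 4)) := by
  rcases Nat.even_or_odd' j with ⟨i, rfl | rfl⟩
  · obtain rfl := mem_varsAt_even hM
    rcases Nat.even_or_odd' l with ⟨i', rfl | rfl⟩
    · -- `B₁(2i)` and `B₁(2i')`
      obtain rfl := mem_varsAt_even hM'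
      obtain ⟨k, rfl⟩ : ∃ k, i' = i + k + 1 := ⟨i' - i - 1, by omega⟩
      obtain ⟨t, rfl⟩ : ∃ t, n = i + k + 1 + t := ⟨n - (i + k + 1), by omega⟩
      rw [show 2 * (i + k + 1) = 2 * i + 2 * k + 2 by ring] at hcc ⊢
      rw [rel_ee] at hcc
      rw [altL_set_ee]
      simp only [b1Var_eq]
      rw [tsum_pkChainL_const_mul_kernel, tsum_pkChainL_const_mul_kernel₂]
      exact scal2_le (wβc_le hd c) (wβc_le hd c') ((leaf_b1_b1 x hd hκ i k t c c' hcc).trans (kpow_mono hκ (by omega)))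
    · -- `B₁(2i)` and `B₂(2i'+1)`
      obtain ⟨k, rfl⟩ : ∃ k, i' = i + k := ⟨i' - i, by omega⟩
      obtain ⟨t, rfl⟩ : ∃ t, n = i + k + t + 1 := ⟨n - (i + k) - 1, by omega⟩
      rw [show 2 * (i + k) + 1 = 2 * i + 2 * k + 1 by ring] at hcc ⊢
      rw [rel_eo] at hcc
      rw [altL_set_eo]
      rcases mem_varsAt_odd hM' with rfl | ⟨rfl, rfl⟩
      · simp only [b1Var_eq, b2Var_eq]
        rw [tsum_pkChainL_const_mul_kernel, tsum_pkChainL_const_mul_kernel₂]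
        exact scal2_le (wβc_le hd c) (wβ₁_le hd) ((leaf_b1_b2one x hd hκ i k t c c' hcc).trans (kpow_mono hκ (by omega)))
      · simp only [b1Var_eq, stVar_eq]
        rw [tsum_pkChainL_const_mul_kernel, tsum_pkChainL_const_mul_kernel₂]
        exact scal2_le (wβc_le hd c) (wβ₁_le hd) ((leaf_b1_star x hd hκ i k t c hcc).trans (kpow_mono hκ (by omega)))
  · rcases Nat.even_or_odd' l with ⟨i', rfl | rfl⟩
    · -- `B₂(2i+1)` and `B₁(2i')`
      obtain rfl := mem_varsAt_even hM'
      obtain ⟨k, rfl⟩ : ∃ k, i' = i + k + 1 := ⟨i' - i - 1, by omega⟩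
      obtain ⟨t, rfl⟩ : ∃ t, n = i + k + 1 + t := ⟨n - (i + k + 1), by omega⟩
      rw [show 2 * (i + k + 1) = 2 * i + 2 * k + 2 by ring] at hcc ⊢
      rw [rel_oe] at hcc
      rw [altL_set_oe]
      rcases mem_varsAt_odd hM with rfl | ⟨rfl, rfl⟩
      · simp only [b1Var_eq, b2Var_eq]
        rw [tsum_pkChainL_const_mul_kernel, tsum_pkChainL_const_mul_kernel₂]
        exact scal2_le (wβ₁_le hd) (wβc_le hd c') ((leaf_b2one_b1 x hd hκ i k t c c' hcc).trans (kpow_mono hκ (by omega)))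
      · simp only [b1Var_eq, stVar_eq]
        rw [tsum_pkChainL_const_mul_kernel, tsum_pkChainL_const_mul_kernel₂]
        exact scal2_le (wβ₁_le hd) (wβc_le hd c') ((leaf_star_b1 x hd hκ i k t c' hcc).trans (kpow_mono hκ (by omega)))
    · -- `B₂(2i+1)` and `B₂(2i'+1)`
      obtain ⟨k, rfl⟩ : ∃ k, i' = i + k + 1 := ⟨i' - i - 1, by omega⟩
      obtain ⟨t, rfl⟩ : ∃ t, n = i + k + t + 2 := ⟨n - (i + k + 1) - 1, by omega⟩
      rw [show 2 * (i + k + 1) + 1 = 2 * i + 2 * k + 3 by ring] at hcc ⊢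
      rw [rel_oo] at hcc
      rw [altL_set_oo]
      rcases mem_varsAt_odd hM with rfl | ⟨rfl, rfl⟩ <;> rcases mem_varsAt_odd hM' with rfl | ⟨rfl, rfl⟩
      · simp only [b2Var_eq]
        rw [tsum_pkChainL_const_mul_kernel, tsum_pkChainL_const_mul_kernel₂]
        exact scal2_le (wβ₁_le hd) (wβ₁_le hd) ((leaf_b2one_b2one x hd i k t c c').trans (kpow_mono hκ (by omega)))
      · simp only [b2Var_eq, stVar_eq]
        rw [tsum_pkChainL_const_mul_kernel, tsum_pkChainL_const_mul_kernel₂]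
        exact scal2_le (wβ₁_le hd) (wβ₁_le hd) ((leaf_b2one_star x hd hκ i k t c hcc).trans (kpow_mono hκ (by omega)))
      · simp only [b2Var_eq, stVar_eq]
        rw [tsum_pkChainL_const_mul_kernel, tsum_pkChainL_const_mul_kernel₂]
        exact scal2_le (wβ₁_le hd) (wβ₁_le hd) ((leaf_star_b2one x hd hκ i k t c' hcc).trans (kpow_mono hκ (by omega)))
      · simp only [stVar_eq]
        rw [tsum_pkChainL_const_mul_kernel, tsum_pkChainL_const_mul_kernel₂]
        exact scal2_le (wβ₁_le hd) (wβ₁_le hd) ((leaf_star_star x hd hκ i k t hcc).trans (kpow_mono hκ (by omega)))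

/-- **An erased start line (strand with start coordinate `c`) and a mark inside the stages** at `l`
(on the other strand, coordinate `c'`): `≤ β 𝕂¹⁸ κ^{n-4}` (the start weight is carried by the start
vector). [cite: Hara2008, §3.5] -/
theorem V_pair_le (c : Bool) (l : ℕ) (hl : l < 2 * n + 1) (c' : Bool) (hcc : c' = xor c (cAt l))
    {M' : Site d × Site d → Site d × Site d → ℝ≥0∞} (hM' : M' ∈ varsAt d b l c') :
    ∑' s, pkChainL (fun P => stEr d c (0, 0) P) ((altL d true (2 * n + 1)).set l M') s * kA3end d s x ≤
      wβ d b * (bigK d ^ 18 * kap d ^ (n - 4)) := by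
  rw [pkChainL_row_eq_vDelta]
  rcases Nat.even_or_odd' l with ⟨i', rfl | rfl⟩
  · obtain rfl := mem_varsAt_even hM'
    obtain ⟨t, rfl⟩ : ∃ t, n = i' + t := ⟨n - i', by omega⟩
    rw [altL_set_e]
    show ∑' s, pkChainL (vDelta d) ([] ++ stEr d c :: (altL d true (2 * i') ++
      (fun p q => wβc d b c' * b1Er d c' p q) :: altL d false (2 * t))) s * kA3end d s x ≤ _
    rw [tsum_pkChainL_const_mul_kernel₂]
    exact mul_le_mul' (wβc_le hd c') ((leaf_V_b1 x hd hκ i' t c c' hcc).trans (kpow_mono hκ (by omega)))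
  · obtain ⟨t, rfl⟩ : ∃ t, n = i' + t + 1 := ⟨n - i' - 1, by omega⟩
    rw [altL_set_o]
    rcases mem_varsAt_odd hM' with rfl | ⟨rfl, rfl⟩
    · show ∑' s, pkChainL (vDelta d) ([] ++ stEr d c :: (altL d true (2 * i' + 1) ++
        (fun p q => wβ₁ b * kRungL (kRungR (b2oneCore d c')) p q) :: altL d true (2 * t + 1))) s * kA3end d s x ≤ _
      rw [tsum_pkChainL_const_mul_kernel₂]
      exact mul_le_mul' (wβ₁_le hd) ((leaf_V_b2one x hd i' t c c').trans (kpow_mono hκ (by omega)))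
    · show ∑' s, pkChainL (vDelta d) ([] ++ stEr d c :: (altL d true (2 * i' + 1) ++
        (fun p q => wβ₁ b * kB2twoEr d p q) :: altL d true (2 * t + 1))) s * kA3end d s x ≤ _
      rw [tsum_pkChainL_const_mul_kernel₂]
      exact mul_le_mul' (wβ₁_le hd) ((leaf_V_star x hd hκ i' t c hcc).trans (kpow_mono hκ (by omega)))

/-- **A mark inside the stages at `j` (strand on coordinate `c`) and the erased end line** of the
other strand (final coordinate `cx`): `≤ β 𝕂¹⁸ κ^{n-4}`. [cite: Hara2008, §3.5] -/
theorem pair_E_le (j : ℕ) (hj : j < 2 * n + 1) (c cx : Bool) (hcc : cx = (!xor c (xor (cAt j) (cAt (2 * n + 1)))))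
    {M : Site d × Site d → Site d × Site d → ℝ≥0∞} (hM : M ∈ varsAt d b j c) :
    ∑' s, pkChainL (kPsiZero d) ((altL d true (2 * n + 1)).set j M) s * enEr d cx s (x, x) ≤
      wβ d b * (bigK d ^ 18 * kap d ^ (n - 4)) := by
  rcases Nat.even_or_odd' j with ⟨i, rfl | rfl⟩
  · obtain rfl := mem_varsAt_even hM
    obtain ⟨t, rfl⟩ : ∃ t, n = i + t := ⟨n - i, by omega⟩
    rw [rel_eE] at hcc
    rw [altL_set_e, tsum_end_eq]
    simp only [b1Var_eq]
    rw [tsum_pkChainL_const_mul_kernel]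
    exact mul_le_mul' (wβc_le hd c) ((leaf_b1_E x hd hκ i t c cx hcc).trans (kpow_mono hκ (by omega)))
  · obtain ⟨t, rfl⟩ : ∃ t, n = i + t + 1 := ⟨n - i - 1, by omega⟩
    rw [rel_oE] at hcc
    rw [altL_set_o, tsum_end_eq]
    rcases mem_varsAt_odd hM with rfl | ⟨rfl, rfl⟩
    · simp only [b2Var_eq]
      rw [tsum_pkChainL_const_mul_kernel]
      exact mul_le_mul' (wβ₁_le hd) ((leaf_b2one_E x hd i t c cx).trans (kpow_mono hκ (by omega)))
    · simp only [stVar_eq]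
      rw [tsum_pkChainL_const_mul_kernel]
      exact mul_le_mul' (wβ₁_le hd) ((leaf_star_E x hd hκ i t cx hcc).trans (kpow_mono hκ (by omega)))

/-- **The erased start line of one strand and the erased end line of the other.** [cite: Hara2008, §3.5] -/
theorem V_E_le (n : ℕ) (c cx : Bool) :
    ∑' s, pkChainL (fun P => stEr d c (0, 0) P) (altL d true (2 * n + 1)) s * enEr d cx s (x, x) ≤
      bigK d ^ 18 * kap d ^ (n - 4) := by
  rw [pkChainL_row_eq_vDelta]
  have h := tsum_end_eq (vDelta d) [] (altL d true (2 * n + 1)) (stEr d c) (enEr d cx) (x, x)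
  rw [List.nil_append] at h
  rw [h]
  exact (leaf_V_E x hd n c cx).trans (kpow_mono hκ (by omega))

/-- **Both lines of one kernel erased** (position `j`). [cite: Hara2008, §3.5] -/
theorem same_le (j : ℕ) (hj : j < 2 * n + 1) :
    ∑' s, pkChainL (kPsiZero d) ((altL d true (2 * n + 1)).set j (bothAt d b j)) s * kA3end d s x ≤
      wβ d b ^ 2 * (bigK d ^ 18 * kap d ^ (n - 4)) := by
  rcases Nat.even_or_odd' j with ⟨i, rfl | rfl⟩
  · obtain ⟨t, rfl⟩ : ∃ t, n = i + t := ⟨n - i, by omega⟩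
    rw [bothAt_even, altL_set_e]
    simp only [b1Both_eq]
    rw [tsum_pkChainL_const_mul_kernel]
    calc wβ₁ b * wβ₂ d b * ∑' s, pkChainL (kPsiZero d) (altL d true (2 * i) ++ kProp (oneF d) (oneF d) ::
          altL d false (2 * t)) s * kA3end d s x ≤ wβ d b * wβ d b * (bigK d ^ 18 * kap d ^ (i + t - 4)) :=
          mul_le_mul' (mul_le_mul' (wβ₁_le hd) wβ₂_le) ((cfg_same_B1 hd i t x).trans (kpow_mono hκ (by omega)))
      _ = wβ d b ^ 2 * (bigK d ^ 18 * kap d ^ (i + t - 4)) := by ring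
  · obtain ⟨t, rfl⟩ : ∃ t, n = i + t + 1 := ⟨n - i - 1, by omega⟩
    rw [bothAt_odd, altL_set_o]
    simp only [b2Both_eq]
    rw [tsum_pkChainL_const_mul_kernel, altL_true_two_mul_add_one i, List.append_assoc, List.singleton_append,
      altL_true_succ (2 * t)]
    exact mul_le_mul' (pow_le_pow_left' (wβ₁_le hd) 2) ((cfg_same_B2 hd i t x).trans (kpow_mono hκ (by omega)))

/-- **Both start lines erased.** [cite: Hara2008, §3.5] -/
theorem V12_le (n : ℕ) :
    ∑' s, pkChainL (fun P => wβ₁ b ^ 2 * rho d P) (altL d true (2 * n + 1)) s * kA3end d s x ≤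
      wβ d b ^ 2 * (bigK d ^ 18 * kap d ^ (n - 4)) := by
  rw [tsum_pkChainL_const_mul_start, tsum_pkChainL_mul]
  exact mul_le_mul' (pow_le_pow_left' (wβ₁_le hd) 2) ((cfg_same_V hd n x).trans (kpow_mono hκ (by omega)))

/-- **Both end lines erased.** [cite: Hara2008, §3.5] -/
theorem E12_le (n : ℕ) :
    ∑' s, pkChainL (kPsiZero d) (altL d true (2 * n + 1)) s * (wβ₁ b ^ 2 * rho d s) ≤
      wβ d b ^ 2 * (bigK d ^ 18 * kap d ^ (n - 4)) := by
  calc ∑' s, pkChainL (kPsiZero d) (altL d true (2 * n + 1)) s * (wβ₁ b ^ 2 * rho d s)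
      = wβ₁ b ^ 2 * ∑' s, pkChainL (kPsiZero d) (altL d true (2 * n) ++ [kB1 d]) s * rho d s := by
        rw [tsum_mul_const_mul, altL_true_two_mul_add_one n]
    _ ≤ wβ d b ^ 2 * (bigK d ^ 18 * kap d ^ (n - 4)) :=
        mul_le_mul' (pow_le_pow_left' (wβ₁_le hd) 2) ((cfg_same_E hd n).trans (kpow_mono hκ (by omega)))

end Dispatch

/-! ### Counting the variants and the two-long-lines bound on the diagram -/

/-- A list sum of closed chains each at most `T` is at most `|L| · T`. [folklore] -/
theorem tsum_lvsum_le {α : Type*} (L : List (α × α → ℝ≥0∞)) (f : α × α → ℝ≥0∞) {T : ℝ≥0∞}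
    (h : ∀ w ∈ L, ∑' p, w p * f p ≤ T) : ∑' p, lvsum L p * f p ≤ L.length * T := by
  rw [tsum_lvsum_mul, ← List.length_map (f := fun w => ∑' p, w p * f p)]
  refine list_sum_le_length_mul fun a ha => ?_
  obtain ⟨w, hw, rfl⟩ := List.mem_map.1 ha
  exact h w hw

section Main

variable (hd : 1 ≤ d) (hκ : kap d ≤ 1) {x : Site d} (hx : x ≠ 0) {b : ℝ} {n : ℕ}
  (hb : ∀ y : Site d, euclidNorm x / (2 * (((n + 1 : ℕ)) : ℝ) + 1) - 1 ≤ euclidNorm y → tau d (criticalProbI d) 0 y ≤ b)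
include hd hκ hx hb

omit hd hκ hx hb in
/-- Every stage of the list has at most two variants of each kind. [folklore] -/
theorem stagesL_lengths : ∀ S ∈ stagesL d b n, S.K1.length ≤ 2 ∧ S.K2.length ≤ 2 ∧ S.K12.length ≤ 2 := by
  intro S hS
  simp only [stagesL, stagesFrom, List.mem_map] at hS
  obtain ⟨j, _, rfl⟩ := hS
  exact stageAt_lengths j

/-- **Hara's two-long-lines bound on the diagram of `Π^{(n+1)}_{p_c}`, in `[0, ∞]`**:
`piNDiagramPc d (n+1) x ≤ 22 (2n+1)² β² 𝕂¹⁸ κ^{n-4}` for `x ≠ 0`, `d ≥ 1`, `κ ≤ 1` and every `b`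
dominating `G` on `|y| ≥ |x|/(2n+3) - 1` (`β = 2d·b⁺`). The diagram is the unmarked run of the
two-strand insertion; its doubly marked variants are the leaves of the previous file; there are at
most `22(2n+1)²` of them. [cite: Hara2008, §3.5 (closing paragraph)] -/
theorem piNDiagramPc_succ_le_sum :
    piNDiagramPc d (n + 1) x ≤ 22 * (2 * (n : ℝ≥0∞) + 1) ^ 2 * (wβ d b ^ 2 * (bigK d ^ 18 * kap d ^ (n - 4))) := by
  set B := wβ d b ^ 2 * (bigK d ^ 18 * kap d ^ (n - 4)) with hB
  set r : ℝ := euclidNorm x / (2 * (n : ℝ) + 3) with hr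
  set cE := cAt (2 * n + 1) with hcE
  -- the run of the insertion
  have hlast : lastReaders (crd true) (crd false) (stagesL d b n) = (crd cE, crd (!cE)) := lastReaders_stagesL n
  have he₁ : ∀ p, ((1 : ℕ) : ℝ) * r ≤ euclidNorm (x - (lastReaders (crd true) (crd false) (stagesL d b n)).1 p) →
      kA3end d p x ≤ wβ₁ b * enEr d cE p (x, x) := by
    intro p h
    rw [hlast, Nat.cast_one, one_mul] at h
    exact kA3end_le_enEr hb cE h
  have he₂ : ∀ p, ((1 : ℕ) : ℝ) * r ≤ euclidNorm (x - (lastReaders (crd true) (crd false) (stagesL d b n)).2 p) →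
      kA3end d p x ≤ wβ₁ b * enEr d (!cE) p (x, x) := by
    intro p h
    rw [hlast, Nat.cast_one, one_mul] at h
    exact kA3end_le_enEr hb (!cE) h
  have he₂₁ : ∀ p, ((1 : ℕ) : ℝ) * r ≤ euclidNorm (x - (lastReaders (crd true) (crd false) (stagesL d b n)).2 p) →
      wβ₁ b * enEr d cE p (x, x) ≤ wβ₁ b ^ 2 * rho d p := by
    intro p h
    rw [hlast, Nat.cast_one, one_mul] at h
    exact enEr_le_rho hb cE h
  have hcount₁ : count₁ (stagesL d b n) = 2 * n + 1 := count₁_stagesFrom 0 _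
  have hcount₂ : count₂ (stagesL d b n) = 2 * n + 1 := count₂_stagesFrom 0 _
  have h3 : (2 * (n : ℝ) + 3) ≠ 0 := by positivity
  have hx₁ : ((1 + count₁ (stagesL d b n) + 1 : ℕ) : ℝ) * r ≤ euclidNorm (x - 0) := by
    rw [hcount₁, sub_zero, show ((1 + (2 * n + 1) + 1 : ℕ) : ℝ) = 2 * (n : ℝ) + 3 by push_cast; ring, hr]
    exact le_of_eq (by field_simp)
  have hx₂ : ((1 + count₂ (stagesL d b n) + 1 : ℕ) : ℝ) * r ≤ euclidNorm (x - 0) := by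
    rw [hcount₂, sub_zero, show ((1 + (2 * n + 1) + 1 : ℕ) : ℝ) = 2 * (n : ℝ) + 3 by push_cast; ring, hr]
    exact le_of_eq (by field_simp)
  have hrun := tsum_M0_mul_le (fun a c => euclidNorm_add_le a c) (start_inv hb) (stagesL d b n) (stagesL_valid hb hx)
    he₁ he₂ he₂₁ hx₁ hx₂
  -- the left-hand side is the diagram
  rw [mRun_M0_eq, kernels_stagesL] at hrun
  have hLHS : piNDiagramPc d (n + 1) x = ∑' p, pkChainL (kPsiZero d) (altL d true (2 * n + 1)) p * kA3end d p x := by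
    rw [piNDiagramPc_succ_eq_tsum_fineChain, kFine_eq_altL]
  rw [hLHS]
  refine hrun.trans ?_
  -- expand the four accumulators
  rw [mRun_M12_eq, mRun_M2_eq, mRun_M1_eq, kernels_stagesL]
  simp only [add_mul, ENNReal.tsum_add]
  -- lengths
  have hlen := length_stagesL (d := d) (b := b) n
  have hL1a : ((L1 (fun P => wβ₁ b * stEr d false (0, 0) P) (stagesL d b n)).length : ℝ≥0∞) ≤ 2 * (2 * n + 1) := by
    have h := length_L1_le (m := 2) (stagesL d b n) (fun P => wβ₁ b * stEr d false (0, 0) P) fun S hS => (stagesL_lengths S hS).1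
    rw [hlen] at h; exact_mod_cast h
  have hL2a : ((L2 (fun P => wβ₁ b * stEr d true (0, 0) P) (stagesL d b n)).length : ℝ≥0∞) ≤ 2 * (2 * n + 1) := by
    have h := length_L2_le (m := 2) (stagesL d b n) (fun P => wβ₁ b * stEr d true (0, 0) P) fun S hS => (stagesL_lengths S hS).2.1
    rw [hlen] at h; exact_mod_cast h
  have hL12 : ((L12 (kPsiZero d) (stagesL d b n)).length : ℝ≥0∞) ≤ 2 * (2 * n + 1) + 2 * 2 ^ 2 * (2 * n + 1) ^ 2 := by
    have h := length_L12_le (m := 2) (stagesL d b n) (kPsiZero d) stagesL_lengths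
    rw [hlen] at h; exact_mod_cast h
  have hL2b : ((L2 (kPsiZero d) (stagesL d b n)).length : ℝ≥0∞) ≤ 2 * (2 * n + 1) := by
    have h := length_L2_le (m := 2) (stagesL d b n) (kPsiZero d) fun S hS => (stagesL_lengths S hS).2.1
    rw [hlen] at h; exact_mod_cast h
  have hL1b : ((L1 (kPsiZero d) (stagesL d b n)).length : ℝ≥0∞) ≤ 2 * (2 * n + 1) := by
    have h := length_L1_le (m := 2) (stagesL d b n) (kPsiZero d) fun S hS => (stagesL_lengths S hS).1
    rw [hlen] at h; exact_mod_cast h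
  -- the nine families
  have f1 : ∑' p, pkChainL (fun P => wβ₁ b ^ 2 * rho d P) (altL d true (2 * n + 1)) p * kA3end d p x ≤ B := V12_le hd hκ x n
  have f2 : ∑' p, lvsum (L1 (fun P => wβ₁ b * stEr d false (0, 0) P) (stagesL d b n)) p * kA3end d p x ≤ 2 * (2 * n + 1) * B := by
    refine (tsum_lvsum_le _ _ fun w hw => ?_).trans (mul_le_mul' hL1a le_rfl)
    obtain ⟨j, hj, M, hM, rfl⟩ := mem_L1 _ _ _ hw
    rw [stagesL_get] at hM
    rw [kernels_stagesL, tsum_pkChainL_const_mul_start]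
    rw [hlen] at hj
    calc wβ₁ b * ∑' q, pkChainL (fun q => stEr d false (0, 0) q) ((altL d true (2 * n + 1)).set j M) q * kA3end d q x
        ≤ wβ d b * (wβ d b * (bigK d ^ 18 * kap d ^ (n - 4))) :=
          mul_le_mul' (wβ₁_le hd) (V_pair_le hd hκ x false j hj (cAt j) (Bool.false_xor _).symm hM)
      _ = B := by rw [hB]; ring
  have f3 : ∑' p, lvsum (L2 (fun P => wβ₁ b * stEr d true (0, 0) P) (stagesL d b n)) p * kA3end d p x ≤ 2 * (2 * n + 1) * B := by
    refine (tsum_lvsum_le _ _ fun w hw => ?_).trans (mul_le_mul' hL2a le_rfl)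
    obtain ⟨j, hj, M, hM, rfl⟩ := mem_L2 _ _ _ hw
    rw [stagesL_get] at hM
    rw [kernels_stagesL, tsum_pkChainL_const_mul_start]
    rw [hlen] at hj
    calc wβ₁ b * ∑' q, pkChainL (fun q => stEr d true (0, 0) q) ((altL d true (2 * n + 1)).set j M) q * kA3end d q x
        ≤ wβ d b * (wβ d b * (bigK d ^ 18 * kap d ^ (n - 4))) :=
          mul_le_mul' (wβ₁_le hd) (V_pair_le hd hκ x true j hj (!cAt j) (Bool.true_xor _).symm hM)
      _ = B := by rw [hB]; ring
  have f4 : ∑' p, lvsum (L12 (kPsiZero d) (stagesL d b n)) p * kA3end d p x ≤ (2 * (2 * n + 1) + 2 * 2 ^ 2 * (2 * n + 1) ^ 2) * B := by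
    refine (tsum_lvsum_le _ _ fun w hw => ?_).trans (mul_le_mul' hL12 le_rfl)
    rcases mem_L12 _ _ _ hw with ⟨j, hj, M, hM, rfl⟩ | ⟨j, l, hj, hl, hjl, hh⟩
    · rw [stagesL_get] at hM
      have hM' : M = bothAt d b j := by simpa [stageAt] using hM
      rw [hlen] at hj
      rw [kernels_stagesL, hM']
      exact same_le hd hκ x j hj
    · rw [hlen] at hj hl
      rcases hh with ⟨M, hM, M', hM', rfl⟩ | ⟨M, hM, M', hM', rfl⟩
      · rw [stagesL_get] at hM hM'
        rw [kernels_stagesL]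
        exact pair_le hd hκ x j l hjl hl (cAt j) (!cAt l) (by cases cAt j <;> cases cAt l <;> rfl) hM hM'
      · rw [stagesL_get] at hM hM'
        rw [kernels_stagesL]
        exact pair_le hd hκ x j l hjl hl (!cAt j) (cAt l) (by cases cAt j <;> cases cAt l <;> rfl) hM hM'
  have f5 : ∑' p, pkChainL (fun P => wβ₁ b * stEr d false (0, 0) P) (altL d true (2 * n + 1)) p * (wβ₁ b * enEr d cE p (x, x)) ≤ B := by
    rw [tsum_pkChainL_const_mul_start, tsum_mul_const_mul]
    calc wβ₁ b * (wβ₁ b * ∑' p, pkChainL (fun P => stEr d false (0, 0) P) (altL d true (2 * n + 1)) p * enEr d cE p (x, x))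
        ≤ wβ d b * (wβ d b * (bigK d ^ 18 * kap d ^ (n - 4))) :=
          mul_le_mul' (wβ₁_le hd) (mul_le_mul' (wβ₁_le hd) (V_E_le hd hκ x n false cE))
      _ = B := by rw [hB]; ring
  have f6 : ∑' p, lvsum (L2 (kPsiZero d) (stagesL d b n)) p * (wβ₁ b * enEr d cE p (x, x)) ≤ 2 * (2 * n + 1) * B := by
    refine (tsum_lvsum_le _ _ fun w hw => ?_).trans (mul_le_mul' hL2b le_rfl)
    obtain ⟨j, hj, M, hM, rfl⟩ := mem_L2 _ _ _ hw
    rw [stagesL_get] at hM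
    rw [hlen] at hj
    rw [kernels_stagesL]
    calc ∑' q, pkChainL (kPsiZero d) ((altL d true (2 * n + 1)).set j M) q * (wβ₁ b * enEr d cE q (x, x))
        = wβ₁ b * ∑' q, pkChainL (kPsiZero d) ((altL d true (2 * n + 1)).set j M) q * enEr d cE q (x, x) :=
          tsum_mul_const_mul _ _ _
      _ ≤ wβ d b * (wβ d b * (bigK d ^ 18 * kap d ^ (n - 4))) :=
          mul_le_mul' (wβ₁_le hd) (pair_E_le hd hκ x j hj (!cAt j) cE
            (by rw [hcE]; cases cAt j <;> cases cAt (2 * n + 1) <;> rfl) hM)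
      _ = B := by rw [hB]; ring
  have f7 : ∑' p, pkChainL (fun P => wβ₁ b * stEr d true (0, 0) P) (altL d true (2 * n + 1)) p * (wβ₁ b * enEr d (!cE) p (x, x)) ≤ B := by
    rw [tsum_pkChainL_const_mul_start, tsum_mul_const_mul]
    calc wβ₁ b * (wβ₁ b * ∑' p, pkChainL (fun P => stEr d true (0, 0) P) (altL d true (2 * n + 1)) p * enEr d (!cE) p (x, x))
        ≤ wβ d b * (wβ d b * (bigK d ^ 18 * kap d ^ (n - 4))) :=
          mul_le_mul' (wβ₁_le hd) (mul_le_mul' (wβ₁_le hd) (V_E_le hd hκ x n true (!cE)))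
      _ = B := by rw [hB]; ring
  have f8 : ∑' p, lvsum (L1 (kPsiZero d) (stagesL d b n)) p * (wβ₁ b * enEr d (!cE) p (x, x)) ≤ 2 * (2 * n + 1) * B := by
    refine (tsum_lvsum_le _ _ fun w hw => ?_).trans (mul_le_mul' hL1b le_rfl)
    obtain ⟨j, hj, M, hM, rfl⟩ := mem_L1 _ _ _ hw
    rw [stagesL_get] at hM
    rw [hlen] at hj
    rw [kernels_stagesL]
    calc ∑' q, pkChainL (kPsiZero d) ((altL d true (2 * n + 1)).set j M) q * (wβ₁ b * enEr d (!cE) q (x, x))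
        = wβ₁ b * ∑' q, pkChainL (kPsiZero d) ((altL d true (2 * n + 1)).set j M) q * enEr d (!cE) q (x, x) :=
          tsum_mul_const_mul _ _ _
      _ ≤ wβ d b * (wβ d b * (bigK d ^ 18 * kap d ^ (n - 4))) :=
          mul_le_mul' (wβ₁_le hd) (pair_E_le hd hκ x j hj (cAt j) (!cE)
            (by rw [hcE]; cases cAt j <;> cases cAt (2 * n + 1) <;> rfl) hM)
      _ = B := by rw [hB]; ring
  have f9 : ∑' p, pkChainL (kPsiZero d) (altL d true (2 * n + 1)) p * (wβ₁ b ^ 2 * rho d p) ≤ B := E12_le hd hκ n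
  -- add up
  have hM1 : (1 : ℝ≥0∞) ≤ 2 * n + 1 := le_add_self
  calc (∑' p, pkChainL (fun P => wβ₁ b ^ 2 * rho d P) (altL d true (2 * n + 1)) p * kA3end d p x) +
        (∑' p, lvsum (L1 (fun P => wβ₁ b * stEr d false (0, 0) P) (stagesL d b n)) p * kA3end d p x) +
        (∑' p, lvsum (L2 (fun P => wβ₁ b * stEr d true (0, 0) P) (stagesL d b n)) p * kA3end d p x) +
        (∑' p, lvsum (L12 (kPsiZero d) (stagesL d b n)) p * kA3end d p x) +
        ((∑' p, pkChainL (fun P => wβ₁ b * stEr d false (0, 0) P) (altL d true (2 * n + 1)) p * (wβ₁ b * enEr d cE p (x, x))) +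
          ∑' p, lvsum (L2 (kPsiZero d) (stagesL d b n)) p * (wβ₁ b * enEr d cE p (x, x))) +
        ((∑' p, pkChainL (fun P => wβ₁ b * stEr d true (0, 0) P) (altL d true (2 * n + 1)) p * (wβ₁ b * enEr d (!cE) p (x, x))) +
          ∑' p, lvsum (L1 (kPsiZero d) (stagesL d b n)) p * (wβ₁ b * enEr d (!cE) p (x, x))) +
        ∑' p, pkChainL (kPsiZero d) (altL d true (2 * n + 1)) p * (wβ₁ b ^ 2 * rho d p)
      ≤ B + 2 * (2 * n + 1) * B + 2 * (2 * n + 1) * B + (2 * (2 * n + 1) + 2 * 2 ^ 2 * (2 * n + 1) ^ 2) * B +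
          (B + 2 * (2 * n + 1) * B) + (B + 2 * (2 * n + 1) * B) + B :=
        add_le_add (add_le_add (add_le_add (add_le_add (add_le_add (add_le_add f1 f2) f3) f4) (add_le_add f5 f6))
          (add_le_add f7 f8)) f9
    _ = (4 + 10 * (2 * n + 1) + 8 * (2 * n + 1) ^ 2) * B := by ring
    _ ≤ (4 * (2 * n + 1) ^ 2 + 10 * (2 * n + 1) ^ 2 + 8 * (2 * n + 1) ^ 2) * B := by
        refine mul_le_mul' (add_le_add (add_le_add ?_ ?_) le_rfl) le_rfl
        · calc (4 : ℝ≥0∞) = 4 * 1 ^ 2 := by ring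
            _ ≤ 4 * (2 * n + 1) ^ 2 := mul_le_mul' le_rfl (pow_le_pow_left' hM1 2)
        · calc (10 : ℝ≥0∞) * (2 * n + 1) = 10 * (2 * n + 1) * 1 := (mul_one _).symm
            _ ≤ 10 * (2 * n + 1) * (2 * n + 1) := mul_le_mul' le_rfl hM1
            _ = 10 * (2 * n + 1) ^ 2 := by ring
    _ = 22 * (2 * (n : ℝ≥0∞) + 1) ^ 2 * B := by ring

end Main

end Literature.Barriers.CriticalPhenomena
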